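import Summits.CriticalPhenomena.Ising3DConformalLimit.Theses.ArmHyperscaling
import Literature.Probability.LatticeModels.HighDimPointwiseTriviality
import Literature.Probability.LatticeModels.ImprovedTreeDiagramBoundProofs
import HarnessLib

/-!
# `OneArmHyperscaling` (item stmt-CriticalPhenomena-15591): what a disproof must show, and the `d ≥ 5` analogue is false modulo a printed theorem

Negative / structural knowledge about the crux
`Summit.CriticalPhenomena.Ising3DConformalLimit.Theses.ArmHyperscaling.OneArmHyperscaling`
(route ArmHyperscaling, r2), from the standing crux disprover (cdisprove, cycle 1; work file
`Cruxes/OneArmHyperscaling/Disproof.lean`, companion of `Negative/KSliceAndExponentLadder.lean`).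
THEOREM-ONLY, no new definitions. Notation: `m⁺_{d,L} = ⟨σ₀⟩⁺_{Λ_L;β_c(d),0}`, `G_d(x) = ⟨σ₀σ_x⟩_{β_c(d)}`.

* `not_oneArmHyperscaling_iff` — the refuter's goal unfolded: the crux fails iff for EVERY ratio
  `K ≥ 1` and every `C` some `n ≥ 1` has `C · G₃(2ne₀) < (m⁺_{3,Kn})²` (unbounded ratio at every `K`,
  i.e. a wired FK-Ising one-arm exponent `< Δσ` on `ℤ³`). Recorded so that Monte-Carlo / series evidence
  is read against the right quantifier pattern (a drift at ONE `K` is not enough).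
* `oneArmHyperscaling_highDim_false_of_meanFieldLowerBound` — **the dimension barrier for this crux as
  a kernel-checked implication**: modulo the mean-field lower bound `m⁺_{d,n} ≥ c/n` (`n ≥ 1`) of
  van Engelenburg–Garban–Panis–Severo, arXiv:2510.23423, Theorem 1.1 (every `d ≥ 2`; printed, not in
  the tree — taken as a hypothesis), the verbatim analogue of the crux in any dimension `d ≥ 5` is FALSE:
  the infrared bound (`exists_criticalTwoPoint_le_inv_pow`) gives `G_d(2ne₀) ≤ C₁ n^{-(d-2)} ≤ C₁ n⁻³`
  against `(m⁺_{d,Kn})² ≥ c²/(Kn)²`. (Their Theorem 1.2 even gives `m⁺_{d,n} ≍ 1/n` for `d > 4`.) So any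
  proof of the crux must consume an input false in `d = 5`
  (`Literature.Barriers.CriticalPhenomena.IsingTrivialityFromDimensionFour`, read for one-arm events);
  the registered line `mirror-face-saturation` isolates that input in `stub_faceSaturation`.

References: D. van Engelenburg, C. Garban, R. Panis, F. Severo, *One-arm exponents of the
high-dimensional Ising model*, arXiv:2510.23423 (2025), Thms 1.1–1.2 and the open problem after Thm 1.12;
J. Fröhlich, B. Simon, T. Spencer, Comm. Math. Phys. 50 (1976) 79; H. Duminil-Copin, *Lectures on the
Ising and Potts models on the hypercubic lattice* (2019), Thm 4.8.
-/

noncomputable section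

namespace Summit.CriticalPhenomena.Ising3DConformalLimit.OneArmHyperscalingNegative

open Literature.Probability.LatticeModels Finset Filter Topology
open Summit.CriticalPhenomena.Ising3DConformalLimit.Theses.ArmHyperscaling (OneArmHyperscaling)

/-- **The refuter's goal, unfolded**: `¬ crux ↔ ∀ K ≥ 1, ∀ C, ∃ n ≥ 1, C·G(2ne₀) < (m⁺_{Kn})²`. [folklore] -/
theorem not_oneArmHyperscaling_iff :
    ¬ OneArmHyperscaling ↔
      ∀ K : ℕ, 1 ≤ K → ∀ C : ℝ, ∃ n : ℕ, 1 ≤ n ∧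
        C * criticalTwoPoint 3 (Pi.single 0 (2 * (n : ℤ))) <
          (isingCorr (zdGraph 3) (box 3 (K * n)) (criticalBeta 3) 0 BoundaryCondition.plus
            ({0} : Finset (Site 3))) ^ 2 := by
  unfold OneArmHyperscaling
  push Not
  rfl

/-- **The `d ≥ 5` analogue of the crux is false, modulo arXiv:2510.23423 Thm 1.1** (the mean-field
one-arm lower bound `m⁺_{d,n} ≥ c/n`, taken as the hypothesis `hLB`): infrared bound
`G_d(2ne₀) ≤ C₁ n^{-(d-2)} ≤ C₁ n⁻³` against `(m⁺_{d,Kn})² ≥ c²/(Kn)²`. [cite: VanEngelenburgGarbanPanisSevero2025, Theorem 1.1] -/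
theorem oneArmHyperscaling_highDim_false_of_meanFieldLowerBound {d : ℕ} (hd : 5 ≤ d)
    (hLB : ∃ c : ℝ, 0 < c ∧ ∀ n : ℕ, 1 ≤ n →
      c / n ≤ isingCorr (zdGraph d) (box d n) (criticalBeta d) 0 BoundaryCondition.plus
        ({0} : Finset (Site d))) :
    ¬ ∃ K : ℕ, 1 ≤ K ∧ ∃ C : ℝ, ∀ n : ℕ, 1 ≤ n →
      (isingCorr (zdGraph d) (box d (K * n)) (criticalBeta d) 0 BoundaryCondition.plus
          ({0} : Finset (Site d))) ^ 2 ≤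
        C * criticalTwoPoint d (Pi.single (⟨0, by omega⟩ : Fin d) (2 * (n : ℤ))) := by
  rintro ⟨K, hK, C, hC⟩
  obtain ⟨c, hc, hlow⟩ := hLB
  obtain ⟨C₁, hC₁, hIR⟩ := exists_criticalTwoPoint_le_inv_pow (d := d) (by omega)
  have hK0 : (0 : ℝ) < K := by exact_mod_cast hK
  set i₀ : Fin d := ⟨0, by omega⟩ with hi₀
  -- the two-point function along the axis decays at least like `n^{-3}`
  have hG : ∀ n : ℕ, 1 ≤ n → criticalTwoPoint d (Pi.single i₀ (2 * (n : ℤ))) ≤ C₁ / (n : ℝ) ^ 3 := by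
    intro n hn
    have hn0 : (0 : ℝ) < n := by exact_mod_cast hn
    have hne : (Pi.single i₀ (2 * (n : ℤ)) : Site d) ≠ 0 := by
      intro h
      have := congrFun h i₀
      simp at this
      omega
    have h1 := hIR _ hne
    have hsup : Site.supNorm (Pi.single i₀ (2 * (n : ℤ)) : Site d) = 2 * n := by
      rw [Site.supNorm_single]; omega
    rw [hsup] at h1
    refine h1.trans ?_
    rw [← div_eq_mul_inv]
    apply div_le_div_of_nonneg_left hC₁ (by positivity)
    calc (n : ℝ) ^ 3 ≤ (n : ℝ) ^ (d - 2) := pow_le_pow_right₀ (by exact_mod_cast hn) (by omega)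
      _ ≤ ((2 * n : ℕ) : ℝ) ^ (d - 2) := by gcongr; exact_mod_cast (by omega : n ≤ 2 * n)
  -- pick `n` beyond the resulting bound `n ≤ max C 0 * C₁ * K² / c²`
  obtain ⟨n, hn⟩ := exists_nat_gt (max C 0 * C₁ * (K : ℝ) ^ 2 / c ^ 2)
  have hn1 : 1 ≤ n + 1 := Nat.succ_le_succ (Nat.zero_le n)
  have hn0 : (0 : ℝ) < (n + 1 : ℕ) := by positivity
  have hm := hlow (K * (n + 1)) (Nat.one_le_iff_ne_zero.2 (Nat.mul_ne_zero (by omega) (by omega)))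
  have hm2 : (c / ((K * (n + 1) : ℕ) : ℝ)) ^ 2 ≤
      isingCorr (zdGraph d) (box d (K * (n + 1))) (criticalBeta d) 0 BoundaryCondition.plus
        ({0} : Finset (Site d)) ^ 2 := pow_le_pow_left₀ (by positivity) hm 2
  have hGpos : 0 ≤ criticalTwoPoint d (Pi.single i₀ (2 * ((n + 1 : ℕ) : ℤ))) :=
    criticalTwoPoint_nonneg' _
  have key := hC (n + 1) hn1
  have h1 : (c / ((K * (n + 1) : ℕ) : ℝ)) ^ 2 ≤ max C 0 * (C₁ / ((n + 1 : ℕ) : ℝ) ^ 3) :=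
    hm2.trans (key.trans ((mul_le_mul_of_nonneg_right (le_max_left _ _) hGpos).trans
      (mul_le_mul_of_nonneg_left (hG (n + 1) hn1) (le_max_right _ _))))
  have h2 : c ^ 2 * ((n + 1 : ℕ) : ℝ) ≤ max C 0 * C₁ * (K : ℝ) ^ 2 := by
    rw [div_pow, div_le_iff₀ (by positivity)] at h1
    have h3 : max C 0 * (C₁ / ((n + 1 : ℕ) : ℝ) ^ 3) * (((K * (n + 1) : ℕ) : ℝ)) ^ 2 =
        max C 0 * C₁ * (K : ℝ) ^ 2 / ((n + 1 : ℕ) : ℝ) := by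
      push_cast; field_simp
    rw [h3, le_div_iff₀ hn0] at h1
    linarith
  rw [div_lt_iff₀ (by positivity)] at hn
  push_cast at h2 hn
  nlinarith

/-- The same barrier, read at `d = 5` explicitly. [cite: VanEngelenburgGarbanPanisSevero2025, Theorem 1.1] -/
theorem oneArmHyperscaling_dimFive_false_of_meanFieldLowerBound
    (hLB : ∃ c : ℝ, 0 < c ∧ ∀ n : ℕ, 1 ≤ n →
      c / n ≤ isingCorr (zdGraph 5) (box 5 n) (criticalBeta 5) 0 BoundaryCondition.plus
        ({0} : Finset (Site 5))) :
    ¬ ∃ K : ℕ, 1 ≤ K ∧ ∃ C : ℝ, ∀ n : ℕ, 1 ≤ n →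
      (isingCorr (zdGraph 5) (box 5 (K * n)) (criticalBeta 5) 0 BoundaryCondition.plus
          ({0} : Finset (Site 5))) ^ 2 ≤ C * criticalTwoPoint 5 (Pi.single 0 (2 * (n : ℤ))) :=
  oneArmHyperscaling_highDim_false_of_meanFieldLowerBound (d := 5) le_rfl hLB

end Summit.CriticalPhenomena.Ising3DConformalLimit.OneArmHyperscalingNegative

end
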